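import Summits.CriticalPhenomena.PercolationContinuityZ3.Theorems.PercNearOneGluingNoHeavyQuantCatHullLeafKinds
import HarnessLib

/-!
# QUANT lane R8, T-DEC: SPLITTING A LEAF CHECK INTO INDEPENDENTLY DECIDABLE PIECES

builds on p205010 (kernel theorem, internal audit signed; external expert review pending)

Support file (`--supports stmt-CriticalPhenomena-4575`), QUANT lane census seat prim-quant-census-2 (gen 78).  Definitions + theorems; standard axioms,
no sorries.  The bisection `Tab.leafSearch` of one leaf shape is a conjunction over the `G`-strips of the table (`Tab.leafSearchOK`) and, inside a
strip, over the two halves chosen by the split rule `Tab.leafBoxSplit`.  This file exposes that structure so that a heavy leaf check can be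
certified by several small kernel evaluations instead of one big one: `Tab.pieceBox` follows a path of halvings from a box, `Tab.leafSearch_of_halves`
/ `Tab.leafSearch_of_pieces` reassemble the search from its sub-boxes (the fuel adds up), `Tab.leafSearchOK_of_strips` reassembles the strips, and
`Tab.leafChk_of_strips` restates it for `Tab.leafChk`.  [this work].  Nothing here is cited as a published result.  The gluing rows served
[cite: KozmaNitzan2024, Conjecture 3 (p. 15)]; product measure [cite: Grimmett1999, §1.3 p. 10].
-/

namespace Summit.CriticalPhenomena.PercolationContinuityZ3.Theorems
namespace Quant
namespace LawDec
namespace Tab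

/-- one halving step under the split rule (`false` = first half, `true` = second half). [this work] -/
def pieceStep (sh : Shape) (y : ℚ) (B : Box) (b : Bool) : Box :=
  cond b (B.halves (leafBoxSplit sh y B)).2 (B.halves (leafBoxSplit sh y B)).1

/-- the sub-box reached from `B` by a path of halvings under the split rule. [this work] -/
def pieceBox (sh : Shape) (y : ℚ) (B : Box) : List Bool → Box
  | [] => B
  | b :: p => pieceBox sh y (pieceStep sh y B b) p

/-- unfolding one step. [this work] -/
theorem pieceBox_cons (sh : Shape) (y : ℚ) (B : Box) (b : Bool) (p : List Bool) :
    pieceBox sh y B (b :: p) = pieceBox sh y (pieceStep sh y B b) p := rfl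

/-- the `false` step is the first half. [this work] -/
theorem pieceStep_false (sh : Shape) (y : ℚ) (B : Box) : pieceStep sh y B false = (B.halves (leafBoxSplit sh y B)).1 := rfl

/-- the `true` step is the second half. [this work] -/
theorem pieceStep_true (sh : Shape) (y : ℚ) (B : Box) : pieceStep sh y B true = (B.halves (leafBoxSplit sh y B)).2 := rfl

/-- the `2^d` paths of length `d`. [this work] -/
def paths : ℕ → List (List Bool)
  | 0 => [[]]
  | d + 1 => ((paths d).map fun p => false :: p) ++ ((paths d).map fun p => true :: p)

/-- one more unit of fuel searches both halves. [this work] -/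
theorem leafSearch_of_halves {sh : Shape} {Pu P0 P1 P2 Q0 Q1 Q2 y : ℚ} {T : Tab} {k fuel : ℕ} {B : Box}
    (h1 : leafSearch sh Pu P0 P1 P2 Q0 Q1 Q2 y T k fuel (pieceStep sh y B false) = true)
    (h2 : leafSearch sh Pu P0 P1 P2 Q0 Q1 Q2 y T k fuel (pieceStep sh y B true) = true) :
    leafSearch sh Pu P0 P1 P2 Q0 Q1 Q2 y T k (fuel + 1) B = true := by
  rw [pieceStep_false] at h1; rw [pieceStep_true] at h2
  unfold leafSearch; simp only [Bool.or_eq_true, Bool.and_eq_true]; exact Or.inr ⟨h1, h2⟩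

/-- **pieces ⟹ whole**: if every depth-`d` sub-box passes with fuel `fuel`, the box passes with fuel `fuel + d`. [this work] -/
theorem leafSearch_of_pieces {sh : Shape} {Pu P0 P1 P2 Q0 Q1 Q2 y : ℚ} {T : Tab} {k : ℕ} :
    ∀ (d fuel : ℕ) (B : Box), (∀ p ∈ paths d, leafSearch sh Pu P0 P1 P2 Q0 Q1 Q2 y T k fuel (pieceBox sh y B p) = true) →
      leafSearch sh Pu P0 P1 P2 Q0 Q1 Q2 y T k (fuel + d) B = true
  | 0, fuel, B, h => h [] (by simp [paths])
  | d + 1, fuel, B, h => by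
    have h1 : leafSearch sh Pu P0 P1 P2 Q0 Q1 Q2 y T k (fuel + d) (pieceStep sh y B false) = true :=
      leafSearch_of_pieces d fuel (pieceStep sh y B false) fun p hp => by
        have := h (false :: p) (by simp only [paths, List.mem_append, List.mem_map]; exact Or.inl ⟨p, hp, rfl⟩)
        rw [pieceBox_cons] at this; exact this
    have h2 : leafSearch sh Pu P0 P1 P2 Q0 Q1 Q2 y T k (fuel + d) (pieceStep sh y B true) = true :=
      leafSearch_of_pieces d fuel (pieceStep sh y B true) fun p hp => by
        have := h (true :: p) (by simp only [paths, List.mem_append, List.mem_map]; exact Or.inr ⟨p, hp, rfl⟩)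
        rw [pieceBox_cons] at this; exact this
    exact leafSearch_of_halves (fuel := fuel + d) (B := B) h1 h2

/-- more fuel never hurts. [this work] -/
theorem leafSearch_mono {sh : Shape} {Pu P0 P1 P2 Q0 Q1 Q2 y : ℚ} {T : Tab} {k : ℕ} :
    ∀ (fuel extra : ℕ) (B : Box), leafSearch sh Pu P0 P1 P2 Q0 Q1 Q2 y T k fuel B = true →
      leafSearch sh Pu P0 P1 P2 Q0 Q1 Q2 y T k (fuel + extra) B = true
  | fuel, 0, B, h => h
  | 0, extra + 1, B, h => by
    unfold leafSearch at h; unfold leafSearch; simp only [Bool.or_eq_true]; exact Or.inl (by simpa using h)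
  | fuel + 1, extra + 1, B, h => by
    have e : fuel + 1 + (extra + 1) = (fuel + (extra + 1)) + 1 := by omega
    rw [e]; unfold leafSearch at h ⊢; simp only [Bool.or_eq_true, Bool.and_eq_true] at h ⊢
    rcases h with h | ⟨h1, h2⟩
    · exact Or.inl h
    · exact Or.inr ⟨leafSearch_mono fuel (extra + 1) _ h1, leafSearch_mono fuel (extra + 1) _ h2⟩

/-- **strips ⟹ whole table**: the per-strip searches give `leafSearchOK`. [this work] -/
theorem leafSearchOK_of_strips {sh : Shape} {Pu P0 P1 P2 Q0 Q1 Q2 y : ℚ} {T : Tab} {fuel n : ℕ} (hn : T.gb.length - 1 = n)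
    (h : ∀ k, k < n → leafSearch sh Pu P0 P1 P2 Q0 Q1 Q2 y T k fuel (T.rootBox k) = true) :
    leafSearchOK sh Pu P0 P1 P2 Q0 Q1 Q2 y T fuel = true := by
  unfold leafSearchOK; rw [List.all_eq_true]; intro k hk; exact h k (hn ▸ List.mem_range.1 hk)

/-- the same for the leaf check of a shape `(a, h0, h1, h2, m)` at offset `u`. [this work] -/
theorem leafChk_of_strips {ψq : ℕ → ℚ} {y : ℚ} {T : Tab} {fuel n u a h0 h1 h2 : ℕ} {m : Mode} (hn : T.gb.length - 1 = n)
    (h : ∀ k, k < n → leafSearch (mkShape a h0 h1 h2 m) (ψq u) (ψq (u + h0)) (ψq (u + h1)) (ψq (u + h2)) (ψq (u + a + h0)) (ψq (u + a + h1))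
      (ψq (u + a + h2)) y T k fuel (T.rootBox k) = true) :
    leafChk ψq y T fuel u a h0 h1 h2 m = true := by
  unfold leafChk; exact leafSearchOK_of_strips hn h

end Tab
end LawDec
end Quant
end Summit.CriticalPhenomena.PercolationContinuityZ3.Theorems
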